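import Summits.ValiantsHypothesis.ValiantsHypothesis.Theorems.SymPencilPerFourTwoRowsRadical
import Mathlib.Data.Complex.Basic

/-!
# Route `SymPencil` — crux `SdcSuperquadratic` (stmt-ValiantsHypothesis-5674), line `box_four`
# (`Cruxes/SdcSuperquadratic/Lines/box_four.lean`, RUNG target `SdcPerFourTwentyOne` = `sdc(per_4) ≥ 21`):
# the registered stub `stub_blockRankFour`, proved verbatim

The stub says: on an `8`-dimensional space `V` of `4 × 4` complex matrices with two prescribed zero
rows (or two prescribed zero columns), it is impossible that for EVERY base point `u` the
`s²`-coefficient of `s ↦ per_4 (u + s y)` (`y ∈ V`) is a quadratic form `Σ_{k<3} c_k (Λ_k y)²` of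
rank `≤ 3`.

Proof (two steps, both elementary):

* `radical_of_sum_sq` — a form `y ↦ Σ_{k ∈ ι} c_k (Λ_k y)²` with `|ι| < dim V` has a non-zero RADICAL
  inside `V`: the common kernel `N = V ⊓ ⋂_k ker Λ_k` is non-zero by rank–nullity
  (`LinearMap.ker_ne_bot_of_finrank_lt` for `y ↦ (Λ_k y)_k : V → K^ι`), and translating by `x₀ ∈ N`
  does not change any `Λ_k`.
* Hence a "rank `≤ 3` family" is a "radical family" in the sense of the landed
  `SymPencilPerFourTwoRowsRadical.false_of_radical_family` (prover val-width-5676-p2 g3, p573105),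
  which is absurd on the two-free-rows block: at `u = 𝟙` on the zero rows the `s²`-coefficient is the
  non-degenerate pairing `2 Σ_{j ≠ j'} y_{a j} y_{b j'}` of the two free rows.  This gives
  `not_sum_three_sq_family` over any field of characteristic `0`, and `stub_blockRankFour` is its
  `ℂ`-instance, stated exactly as registered in the skeleton.

Honest framing: this closes the size-S stub of the line only; the line's other stubs
(`stub_boxFourEq`, landed in substance as `SymPencilBoxFourEquality`; `stub_defectForm`, open) and
the rung `sdc(per_4) ≥ 21` are not claimed here, the crux `SdcSuperquadratic` (a bound past the
number-of-variables wall) stays open, and `VP ≠ VNP` is not moved.  No definitions, no named facts.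
-/

noncomputable section

-- single-conjunct layout: Sub = Summit, duplicated namespace component intended
set_option linter.dupNamespace false

namespace Summit.ValiantsHypothesis.ValiantsHypothesis.Theorems.SymPencilSdcSuperquadraticStubBlockRankFour

open MvPolynomial Module
open Literature.Computability.AlgebraicComplexity
open Summit.ValiantsHypothesis.ValiantsHypothesis.Theorems.SymPencilPerFourTwoRowsRadical

/-- **Radical of a short sum of squares.**  If `|ι| < dim V`, the quadratic form
`y ↦ Σ_{k ∈ ι} c_k (Λ_k y)²` has a non-zero radical inside `V`: a subspace `0 ≠ N ≤ V` (the common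
kernel of the `Λ_k` in `V`) translating by which leaves the form unchanged. [folklore] -/
theorem radical_of_sum_sq {K M ι : Type*} [Field K] [AddCommGroup M] [Module K M] [Fintype ι]
    (V : Submodule K M) [FiniteDimensional K V] (hV : Fintype.card ι < finrank K V)
    (c : ι → K) (Λ : ι → (M →ₗ[K] K)) :
    ∃ N : Submodule K M, N ≤ V ∧ N ≠ ⊥ ∧
      ∀ x₀ ∈ N, ∀ x : M, ∑ k, c k * (Λ k (x₀ + x)) ^ 2 = ∑ k, c k * (Λ k x) ^ 2 := by
  let L : M →ₗ[K] (ι → K) := LinearMap.pi Λ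
  have hker : LinearMap.ker (L.comp V.subtype) ≠ ⊥ :=
    LinearMap.ker_ne_bot_of_finrank_lt (by rwa [finrank_fintype_fun_eq_card])
  obtain ⟨v, hv, hv0⟩ := Submodule.exists_mem_ne_zero_of_ne_bot hker
  refine ⟨(LinearMap.ker (L.comp V.subtype)).map V.subtype, Submodule.map_subtype_le _ _, ?_, ?_⟩
  · rw [Submodule.ne_bot_iff]
    exact ⟨v, ⟨v, hv, rfl⟩, fun h => hv0 (by exact_mod_cast h)⟩
  · rintro _ ⟨w, hw, rfl⟩ x
    have hk : ∀ k, Λ k (w : M) = 0 := fun k => by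
      have h := congr_fun (LinearMap.mem_ker.1 hw) k
      simpa [L] using h
    simp only [Submodule.coe_subtype, map_add, hk, zero_add]

/-- **No rank-`≤ 3` family on the two-free-rows block** (any field of characteristic `0`): on an
`8`-dimensional space of `4 × 4` matrices with two prescribed zero rows or two prescribed zero
columns, the `s²`-coefficient of `per_4 (u + s y)` cannot be of the shape `Σ_{k<3} c_k (Λ_k y)²` for
every base point `u`. [folklore] -/
theorem not_sum_three_sq_family {K : Type*} [Field K] [CharZero K]
    (V : Submodule K (Fin 4 × Fin 4 → K)) (h8 : finrank K V = 8)
    (hV : (∃ p q : Fin 4, p ≠ q ∧ ∀ x ∈ V, ∀ j, x (p, j) = 0 ∧ x (q, j) = 0) ∨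
      (∃ p q : Fin 4, p ≠ q ∧ ∀ x ∈ V, ∀ i, x (i, p) = 0 ∧ x (i, q) = 0)) :
    ¬ (∀ u : Fin 4 × Fin 4 → K, ∃ (c : Fin 3 → K) (Λ : Fin 3 → ((Fin 4 × Fin 4 → K) →ₗ[K] K)),
        ∀ y ∈ V, ∃ e₀ e₁ : K, ∀ s : K,
          eval (u + s • y) (perPoly (Fin 4) K) =
            e₀ + s * e₁ + s ^ 2 * ∑ k, c k * (Λ k y) ^ 2) := by
  intro hform
  refine false_of_radical_family V h8 hV fun u => ?_
  obtain ⟨c, Λ, hcΛ⟩ := hform u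
  obtain ⟨N, hNV, hN, hrad⟩ :=
    radical_of_sum_sq V (by rw [h8, Fintype.card_fin]; norm_num) c Λ
  exact ⟨N, hNV, hN, fun y => ∑ k, c k * (Λ k y) ^ 2, hcΛ, fun x₀ hx₀ x _ => hrad x₀ hx₀ x⟩

/-- **Registered stub `stub_blockRankFour` of line `box_four`** (crux `SdcSuperquadratic`,
stmt-ValiantsHypothesis-5674; rung `SdcPerFourTwentyOne`), verbatim: an `8`-dimensional space of
`4 × 4` complex matrices with two zero rows (or two zero columns) carries no family of
rank-`≤ 3` expressions `Σ_{k<3} c_k (Λ_k y)²` for the `s²`-coefficient of `per_4 (u + s y)` over all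
base points `u`.  The `ℂ`-instance of `not_sum_three_sq_family`. [folklore] -/
theorem stub_blockRankFour :
    ∀ V : Submodule ℂ (Fin 4 × Fin 4 → ℂ), finrank ℂ V = 8 →
      ((∃ p q : Fin 4, p ≠ q ∧ ∀ x ∈ V, ∀ j, x (p, j) = 0 ∧ x (q, j) = 0) ∨
        (∃ p q : Fin 4, p ≠ q ∧ ∀ x ∈ V, ∀ i, x (i, p) = 0 ∧ x (i, q) = 0)) →
      ¬ (∀ u : Fin 4 × Fin 4 → ℂ, ∃ (c : Fin 3 → ℂ) (Λ : Fin 3 → ((Fin 4 × Fin 4 → ℂ) →ₗ[ℂ] ℂ)),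
          ∀ y ∈ V, ∃ e₀ e₁ : ℂ, ∀ s : ℂ,
            eval (u + s • y) (perPoly (Fin 4) ℂ) =
              e₀ + s * e₁ + s ^ 2 * ∑ k, c k * (Λ k y) ^ 2) :=
  fun V h8 hV => not_sum_three_sq_family V h8 hV

/-- **No rank-`< 8` family on the two-free-rows block** — the form of the stub that the lane's
next sizes use (NEXT-RUNG (D): for a symmetric affine determinantal representation of `per_4` of
size `m ≤ 24` with `dim ker b = 8` the defect is `δ = m − 17 ≤ 7`, and the `s²`-coefficient is a sum
of `δ` weighted squares): on an `8`-dimensional space of `4 × 4` matrices with two prescribed zero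
rows or columns, over a field of characteristic `0`, the `s²`-coefficient of `per_4 (u + s y)` cannot
be `Σ_{k ∈ ι} c_k (Λ_k y)²` with `|ι| < 8` for every base point `u` (same proof: `|ι| < dim V` gives a
radical, `false_of_radical_family`). [folklore] -/
theorem not_sum_sq_family_of_card_lt {K ι : Type*} [Field K] [CharZero K] [Fintype ι]
    (hι : Fintype.card ι < 8) (V : Submodule K (Fin 4 × Fin 4 → K)) (h8 : finrank K V = 8)
    (hV : (∃ p q : Fin 4, p ≠ q ∧ ∀ x ∈ V, ∀ j, x (p, j) = 0 ∧ x (q, j) = 0) ∨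
      (∃ p q : Fin 4, p ≠ q ∧ ∀ x ∈ V, ∀ i, x (i, p) = 0 ∧ x (i, q) = 0)) :
    ¬ (∀ u : Fin 4 × Fin 4 → K, ∃ (c : ι → K) (Λ : ι → ((Fin 4 × Fin 4 → K) →ₗ[K] K)),
        ∀ y ∈ V, ∃ e₀ e₁ : K, ∀ s : K,
          eval (u + s • y) (perPoly (Fin 4) K) =
            e₀ + s * e₁ + s ^ 2 * ∑ k, c k * (Λ k y) ^ 2) := by
  intro hform
  refine false_of_radical_family V h8 hV fun u => ?_
  obtain ⟨c, Λ, hcΛ⟩ := hform u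
  obtain ⟨N, hNV, hN, hrad⟩ := radical_of_sum_sq V (by rwa [h8]) c Λ
  exact ⟨N, hNV, hN, fun y => ∑ k, c k * (Λ k y) ^ 2, hcΛ, fun x₀ hx₀ x _ => hrad x₀ hx₀ x⟩

/-- **Pointwise form** of `not_sum_sq_family_of_card_lt` (how a pencil argument consumes it): there
is ONE base point `u` at which the `s²`-coefficient along `V` is not a sum of fewer than `8`
weighted squares of linear forms. [folklore] -/
theorem exists_basePoint_not_sum_sq {K ι : Type*} [Field K] [CharZero K] [Fintype ι]
    (hι : Fintype.card ι < 8) (V : Submodule K (Fin 4 × Fin 4 → K)) (h8 : finrank K V = 8)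
    (hV : (∃ p q : Fin 4, p ≠ q ∧ ∀ x ∈ V, ∀ j, x (p, j) = 0 ∧ x (q, j) = 0) ∨
      (∃ p q : Fin 4, p ≠ q ∧ ∀ x ∈ V, ∀ i, x (i, p) = 0 ∧ x (i, q) = 0)) :
    ∃ u : Fin 4 × Fin 4 → K, ∀ (c : ι → K) (Λ : ι → ((Fin 4 × Fin 4 → K) →ₗ[K] K)),
      ∃ y ∈ V, ∀ e₀ e₁ : K, ∃ s : K,
        eval (u + s • y) (perPoly (Fin 4) K) ≠
          e₀ + s * e₁ + s ^ 2 * ∑ k, c k * (Λ k y) ^ 2 := by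
  by_contra h
  push Not at h
  exact not_sum_sq_family_of_card_lt hι V h8 hV fun u => by
    obtain ⟨c, Λ, hcΛ⟩ := h u
    exact ⟨c, Λ, fun y hy => by
      obtain ⟨e₀, e₁, he⟩ := hcΛ y hy
      exact ⟨e₀, e₁, he⟩⟩

end Summit.ValiantsHypothesis.ValiantsHypothesis.Theorems.SymPencilSdcSuperquadraticStubBlockRankFour

end
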